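import Mathlib
import HarnessLib.Audit
import Summits.PneNP.PneNP.Theorems.PstarCoincidenceExact
import Summits.PneNP.PneNP.Theorems.PstarCentreGateBudgetAssembly

/-!
# The SHARP census node under the gate budget (ROUND-24, O1; memo g26 §59)

FRONTIER range-avoidance ladder, rung F-N3, ROUND 24 (cell `pnp-ideate`, prover-2 memo `g26/O1-LOCALITY-g26.md` §59; typed targets
`PstarCoreBoundTargets.TerminalFive` / `TerminalPeelable` (p646951); restricted-model proof complexity — nothing here bears on `P` versus `NP`).

The chain head of g25, `PstarCentreGateBudgetAssembly.MenuCriterionBoundGateBudget`, asks the census for the COMBINATORIAL branch (B)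
(`NoShortCoincidence c G`).  That test over-flags at large `k`: a clean chord closing a cycle with two chords dirtied by the channel (e.g. a dirty
2-path) fails it whatever the readers are, so an adversary with slack to spare makes arbitrarily many clean chords "fail" combinatorially while
`#sharedSlots` stays put — the census could never certify such structures through that node.  The obstruction the proof actually meets is the
SEMANTIC coincidence (`PstarCoincidenceExact.NoCoincidenceExact`, g24: jointly unsatisfiable readers, every monomial essential, rank bounds), which a
clean triangle of chords never produces (its AND pairs would have to be menu monomials).  This file restates the g25 node with the semantic branch:

* node **`SharpMenuCriterionBoundGateBudget`** — `SharpMenuCriterionBound` (semantic (B)) restricted to the terminal cores with a centre that are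
  covered, anchored, without a clean cut crossed twice, satisfy `GateBudget`, and — when X-connected — have slack `≥ 3` and two dirty chords;
* `sharpGateBudget_of_gateBudget`, `sharpGateBudget_of_sharp` — it is weaker than both `MenuCriterionBoundGateBudget` and `SharpMenuCriterionBound`;
* **`terminalFive_of_sharpMenuBoundGateBudget : TerminalFiveA → node → TerminalFive`**, `terminalPeelable_of_sharpMenuBoundGateBudget`.

So the census node of record is: for every admissible structure and committed channel pair, all but at most `#sharedSlots − 2` skeleton-connected
clean chords have, for each of the four channel menus, NO exact path-sum sub-core (branch (A); locality `PstarMenuLocality.touches_pathSum_side`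
applies) and NO exact coincidence (branch (B); poison rule `PstarCoincidenceExact.false_of_coincidence_junk`).
-/

set_option linter.dupNamespace false -- `Summit.PneNP.PneNP.…`: summit = sub-problem name (D-0017 single-conjunct layout)

open Finset Literature.Computability.Complexity
open Summit.PneNP.PneNP.Theorems.PstarTyped (Typed)
open Summit.PneNP.PneNP.Theorems.PstarSALevel (varSet bdry BoundaryExpanding SimpleOverlap)
open Summit.PneNP.PneNP.Theorems.PstarXCore (xverts)
open Summit.PneNP.PneNP.Theorems.PstarCoreBound (XorClosed)
open Summit.PneNP.PneNP.Theorems.PstarChordRepair (IsChord)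
open Summit.PneNP.PneNP.Theorems.PstarCoreBoundTargets (Terminal TerminalFive TerminalFiveA TerminalPeelable nonchords nonchords_subset mem_nonchords
  terminalPeelable_of_terminalFive)
open Summit.PneNP.PneNP.Theorems.PstarSharingBound (sharedSlots)
open Summit.PneNP.PneNP.Theorems.PstarChordBridgeTools (xpdeg)
open Summit.PneNP.PneNP.Theorems.PstarChordBridgeCentre (exists_maximal_peelable_sup)
open Summit.PneNP.PneNP.Theorems.PstarChordReadOutside (OutsideGated)
open Summit.PneNP.PneNP.Theorems.PstarSliceGenericCriterion (NoShortCoincidence)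
open Summit.PneNP.PneNP.Theorems.PstarSliceGenericInternal (internalMenu internalMenu_subset)
open Summit.PneNP.PneNP.Theorems.PstarCleanChordCount (exists_clean_chords)
open Summit.PneNP.PneNP.Theorems.PstarTerminalPeelableTwelve (exists_centre_of_not_peelable)
open Summit.PneNP.PneNP.Theorems.PstarNoFreeVertex (Covered covered_of_terminal)
open Summit.PneNP.PneNP.Theorems.PstarHangingForest (Anchored anchored_of_terminal)
open Summit.PneNP.PneNP.Theorems.PstarCleanCut (smallCriterion_of_crossing)
open Summit.PneNP.PneNP.Theorems.PstarCleanCutAssembly (false_of_cleanCut_two SkConnected NoTwoCrossings)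
open Summit.PneNP.PneNP.Theorems.PstarTwoCleanExact (MenuGeneric false_of_two_clean_exact)
open Summit.PneNP.PneNP.Theorems.PstarMenuCriterion (NoSmallPathSumSubcoreExact channelMenus subset_of_mem_channelMenus
  noSmallPathSumSubcoreExact_of_subset noShortCoincidence_anti)
open Summit.PneNP.PneNP.Theorems.PstarCoincidenceExact (NoCoincidenceExact SharpMenuCriterionBound noCoincidenceExact_of_noShortCoincidence
  menuGeneric_of_criterionSharp)
open Summit.PneNP.PneNP.Theorems.PstarSkeletonSpan (XConnected)
open Summit.PneNP.PneNP.Theorems.PstarSlackOneCentre (no_centre_at_slack_one)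
open Summit.PneNP.PneNP.Theorems.PstarSlackAssembly (no_centre_at_slack_zero)
open Summit.PneNP.PneNP.Theorems.PstarSlackTwoClean (no_centre_at_slack_two)
open Summit.PneNP.PneNP.Theorems.PstarCentreTwoDirty (exists_two_dirty_of_centre)
open Summit.PneNP.PneNP.Theorems.PstarCentreGateBudgetParts (centre_gate_budget_parts)
open Summit.PneNP.PneNP.Theorems.PstarCentreGateBudgetAssembly (GateBudget MenuCriterionBoundGateBudget)

namespace Summit.PneNP.PneNP.Theorems.PstarSharpGateBudgetAssembly

variable {n m : ℕ}

/-- **`SharpMenuCriterionBoundGateBudget` (OPEN, census-type, semantic (B))**: on every terminal core with a centre that is covered, anchored, has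
no clean cut crossed twice, satisfies `GateBudget` and, when X-connected, has boundary slack at least three and two distinct dirty chords, there is
`ℬ ⊆ J₀` with `#ℬ + 2 ≤ #sharedSlots` such that every skeleton-connected outside-gated chord `c ∉ ℬ` satisfies, for each channel menu `G`,
`NoSmallPathSumSubcoreExact c G` and the EXACT coincidence node `NoCoincidenceExact c G`.  FRONTIER. -/
@[conjecture] def SharpMenuCriterionBoundGateBudget : Prop :=
  ∀ (n m r : ℕ) (I : LocalMap 4 n m), I.IsPure xorAndPred → Typed I → SimpleOverlap I → BoundaryExpanding r I →
    ∀ (y : Fin m → Bool) (J₀ : Finset (Fin m)) (w₁ w₂ : Finset (Fin n) × Finset (Fin m) × Bool), Terminal I r y J₀ w₁ w₂ →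
      (∃ S ⊆ J₀, S.Nonempty ∧ (∀ w ∈ xverts I S, 2 ≤ xpdeg I S w) ∧ ∀ f ∈ S, ¬ IsChord I J₀ f) →
      Covered I J₀ (w₁.2.1 ∪ w₂.2.1) → Anchored I J₀ (w₁.2.1 ∪ w₂.2.1) → NoTwoCrossings I J₀ (w₁.2.1 ∪ w₂.2.1) →
      GateBudget I J₀ (w₁.2.1 ∪ w₂.2.1) →
      (XConnected I J₀ → 3 * J₀.card + 3 ≤ 2 * (bdry I J₀).card ∧
        ∃ d₁ ∈ J₀, ∃ d₂ ∈ J₀, d₁ ≠ d₂ ∧ IsChord I J₀ d₁ ∧ ¬ OutsideGated I J₀ (w₁.2.1 ∪ w₂.2.1) d₁ ∧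
          IsChord I J₀ d₂ ∧ ¬ OutsideGated I J₀ (w₁.2.1 ∪ w₂.2.1) d₂) →
      ∃ ℬ ⊆ J₀, ℬ.card + 2 ≤ (sharedSlots I J₀).card ∧
        ∀ c ∈ J₀, c ∉ ℬ → IsChord I J₀ c → OutsideGated I J₀ (w₁.2.1 ∪ w₂.2.1) c → SkConnected I J₀ (w₁.2.1 ∪ w₂.2.1) c →
          ∀ G ∈ channelMenus I J₀ w₁ w₂, NoSmallPathSumSubcoreExact I r y J₀ c G ∧ NoCoincidenceExact I J₀ c G

/-- The sharp node is weaker than the combinatorial gate-budget node. -/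
theorem sharpGateBudget_of_gateBudget (h : MenuCriterionBoundGateBudget) : SharpMenuCriterionBoundGateBudget := by
  intro n m r I hI hT hS hB y J₀ w₁ w₂ ht hS₀ hcov hanc hN2 hGB hx
  obtain ⟨ℬ, hℬJ, hℬ, hgood⟩ := h n m r I hI hT hS hB y J₀ w₁ w₂ ht hS₀ hcov hanc hN2 hGB hx
  have hdisj : Disjoint J₀ (w₁.2.1 ∪ w₂.2.1) := disjoint_union_right.2 ⟨ht.2.2.2.1, ht.2.2.2.2.1⟩
  refine ⟨ℬ, hℬJ, hℬ, fun c hc hcℬ hch hO hsk G hG => ?_⟩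
  obtain ⟨hA, hBc⟩ := hgood c hc hcℬ hch hO hsk G hG
  exact ⟨hA, noCoincidenceExact_of_noShortCoincidence hI hS
    (hdisj.mono_right ((subset_of_mem_channelMenus hG).trans (internalMenu_subset I J₀ _))) hBc⟩

/-- The sharp node is weaker than the unrestricted sharp node. -/
theorem sharpGateBudget_of_sharp (h : SharpMenuCriterionBound) : SharpMenuCriterionBoundGateBudget := by
  intro n m r I hI hT hS hB y J₀ w₁ w₂ ht hS₀ hcov hanc hN2 _ _
  exact h n m r I hI hT hS hB y J₀ w₁ w₂ ht hS₀ hcov hanc hN2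

/-- **THE CORE BOUND FROM O2 AND THE SHARP NODE UNDER THE GATE BUDGET** — the strong induction of
`PstarCentreGateBudgetAssembly.terminalFive_of_menuBoundGateBudget` with the semantic branch (B). -/
theorem terminalFive_of_sharpMenuBoundGateBudget (hO2 : TerminalFiveA) (hb : SharpMenuCriterionBoundGateBudget) : TerminalFive := by
  classical
  suffices H : ∀ (k n m r : ℕ) (I : LocalMap 4 n m), I.IsPure xorAndPred → Typed I → SimpleOverlap I → BoundaryExpanding r I →
      ∀ (y : Fin m → Bool) (J₀ : Finset (Fin m)) (w₁ w₂ : Finset (Fin n) × Finset (Fin m) × Bool), Terminal I r y J₀ w₁ w₂ →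
        J₀.card = k → J₀.card ≤ 5 from
    fun n m r I hI hT hS hB y J₀ w₁ w₂ ht => H _ n m r I hI hT hS hB y J₀ w₁ w₂ ht rfl
  intro k
  induction k using Nat.strong_induction_on with
  | _ k ih =>
    intro n m r I hI hT hS hB y J₀ w₁ w₂ ht hk
    by_cases hP : PstarChordBridgeCotree.Peelable I (nonchords I J₀)
    · obtain ⟨F, hS₀F, hFJ, hPF, hmax⟩ := exists_maximal_peelable_sup I (nonchords_subset I J₀) hP
      refine hO2 n m r I hI hT hS hB y J₀ w₁ w₂ ht F hFJ hPF hmax fun e he => ?_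
      rw [mem_sdiff] at he
      by_contra hc
      exact he.2 (hS₀F ((mem_nonchords I).2 ⟨he.1, hc⟩))
    · exfalso
      obtain ⟨S, hSJ, hne, hL, hnc⟩ := exists_centre_of_not_peelable I hP
      have hdisj : Disjoint J₀ (w₁.2.1 ∪ w₂.2.1) := disjoint_union_right.2 ⟨ht.2.2.2.1, ht.2.2.2.2.1⟩
      set 𝒢 := w₁.2.1 ∪ w₂.2.1 with h𝒢
      have hIH : ∀ c ∈ J₀, ∀ K₀ ⊆ J₀.erase c, ∀ d₁ d₂ : Finset (Fin n) × Finset (Fin m) × Bool, Terminal I r y K₀ d₁ d₂ → K₀.card ≤ 5 := by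
        intro c hc K₀ hK₀ d₁ d₂ ht₀
        have hlt : K₀.card < k := by
          rw [← hk]
          exact lt_of_le_of_lt (card_le_card hK₀) (card_erase_lt_of_mem hc)
        exact ih K₀.card hlt n m r I hI hT hS hB y K₀ d₁ d₂ ht₀ rfl
      have hbudget : GateBudget I J₀ (w₁.2.1 ∪ w₂.2.1) :=
        fun parts hpK hpcov hpdisj hpsep hpconn S' hS'J hS'ne hS'L hS'nc H hHM hHin D hD N₀ hN₀J hN₀ =>
          centre_gate_budget_parts hI hT hS hB ht hIH parts hpK hpcov hpdisj hpsep hpconn hS'J hS'ne hS'L hS'nc hHM hHin hD hN₀J hN₀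
      have hslack : XConnected I J₀ → 3 * J₀.card + 3 ≤ 2 * (bdry I J₀).card ∧
          ∃ d₁ ∈ J₀, ∃ d₂ ∈ J₀, d₁ ≠ d₂ ∧ IsChord I J₀ d₁ ∧ ¬ OutsideGated I J₀ (w₁.2.1 ∪ w₂.2.1) d₁ ∧
            IsChord I J₀ d₂ ∧ ¬ OutsideGated I J₀ (w₁.2.1 ∪ w₂.2.1) d₂ := by
        intro hconn
        refine ⟨?_, exists_two_dirty_of_centre hI hT hS hB ht hIH hconn ⟨S, hSJ, hne, hL, hnc⟩⟩
        have hexp : 3 * J₀.card ≤ 2 * (bdry I J₀).card := hB J₀ ht.2.2.1.le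
        by_contra h3
        by_cases h0 : 2 * (bdry I J₀).card = 3 * J₀.card
        · exact no_centre_at_slack_zero hI hT hS hB ht hIH hconn h0 ⟨S, hSJ, hne, hL, hnc⟩
        by_cases h1 : 2 * (bdry I J₀).card = 3 * J₀.card + 1
        · exact no_centre_at_slack_one hI hT hS hB ht hIH hconn h1 ⟨S, hSJ, hne, hL, hnc⟩
        have h2 : 2 * (bdry I J₀).card = 3 * J₀.card + 2 := by omega
        exact no_centre_at_slack_two hI hT hS hB ht hIH hconn h2 ⟨S, hSJ, hne, hL, hnc⟩
      have hN2 : NoTwoCrossings I J₀ 𝒢 := fun W e₁ e₂ he₁ he₂ hne hc₁ hc₂ hcut =>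
        false_of_cleanCut_two hI hT hS hB ht hIH hcut he₁ he₂ hne hc₁ hc₂
      obtain ⟨ℬ, -, hℬ, hgood⟩ := hb n m r I hI hT hS hB y J₀ w₁ w₂ ht ⟨S, hSJ, hne, hL, hnc⟩ (covered_of_terminal hI hT hS hB ht)
        (anchored_of_terminal hI hT hS hB ht) hN2 hbudget hslack
      obtain ⟨𝒞, h𝒞J, hch, hO, hcard⟩ := exists_clean_chords hB ht
      have hU : 1 < (𝒞 \ ℬ).card := by
        have := le_card_sdiff ℬ 𝒞
        omega
      obtain ⟨a, ha, b, hb', hab⟩ := one_lt_card.1 hU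
      obtain ⟨ha𝒞, haℬ⟩ := mem_sdiff.1 ha
      obtain ⟨hb𝒞, hbℬ⟩ := mem_sdiff.1 hb'
      have hcrit : ∀ c ∈ 𝒞, c ∉ ℬ → ∀ G ∈ channelMenus I J₀ w₁ w₂,
          NoSmallPathSumSubcoreExact I r y J₀ c G ∧ NoCoincidenceExact I J₀ c G := by
        intro c hc hcℬ G hG
        by_cases hsk : SkConnected I J₀ 𝒢 c
        · exact hgood c (h𝒞J hc) hcℬ (hch c hc) (hO c hc) hsk G hG
        · unfold PstarCleanCutAssembly.SkConnected at hsk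
          push Not at hsk
          obtain ⟨W, hcW, hcut⟩ := hsk
          obtain ⟨hA, hBc⟩ := smallCriterion_of_crossing (y := y) (r := r) hI hT hS hB hdisj (fun f hf hcf => hcut f hf hcf) hcW
          have hGsub := subset_of_mem_channelMenus hG
          exact ⟨noSmallPathSumSubcoreExact_of_subset hA hGsub,
            noCoincidenceExact_of_noShortCoincidence hI hS (hdisj.mono_right (hGsub.trans (internalMenu_subset I J₀ _)))
              (noShortCoincidence_anti hBc hGsub)⟩
      have hgen : ∀ c ∈ 𝒞, c ∉ ℬ → MenuGeneric I y J₀ c w₁ w₂ := fun c hc hcℬ =>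
        menuGeneric_of_criterionSharp hI hT hS hB ht (h𝒞J hc) (hIH c (h𝒞J hc)) (hcrit c hc hcℬ)
      exact false_of_two_clean_exact hI hT hS hB ht (h𝒞J ha𝒞) (h𝒞J hb𝒞) hab (hch a ha𝒞) (hch b hb𝒞) (hO a ha𝒞) (hO b hb𝒞)
        (hgen a ha𝒞 haℬ) (hgen b hb𝒞 hbℬ)

/-- **O1 from the same inputs.** -/
theorem terminalPeelable_of_sharpMenuBoundGateBudget (hO2 : TerminalFiveA) (hb : SharpMenuCriterionBoundGateBudget) : TerminalPeelable :=
  terminalPeelable_of_terminalFive (terminalFive_of_sharpMenuBoundGateBudget hO2 hb)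

end Summit.PneNP.PneNP.Theorems.PstarSharpGateBudgetAssembly
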